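import Summits.BirchSwinnertonDyer.Rank1Residual.Additive.SpecialJSupersingular
import Summits.BirchSwinnertonDyer.Rank1Residual.Additive.MinimalGoodOrdinaryField
import HarnessLib

/-!
# X3♯(G-ord) / X4♯(G-ord): Delbourgo's (G)-ORDINARY = POTENTIALLY GOOD ORDINARY (over ANY number field, at ANY place above `p`)

HONEST FRAMING (cell `b2b-bsdres`, run/shared/lean/b2b/bsd-rank1-residual/, verbatim in every
file): the goal of the cell is to DELETE the COMBINATION-SHAPED residual classes of the
Birch–Swinnerton-Dyer formula for ALL analytic-rank `≤ 1` elliptic curves over `ℚ` — "full BSD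
formula for every rank `≤ 1` curve in class `C`" assembled STRICTLY from published theorems — so
that the rank-`≤ 1` remainder becomes exactly the CONSTRUCTION-SHAPED classes, which are TYPED
(missing-input `Prop`s), NOT attempted. This is not "finishing BSD". Sub-cell `additive-p2`
(CLASS-OWNERS row "X3/X4 additive — pot. good ordinary / X3♯(G-ord)"), generation 9: research
route; no claim beyond the stated classes; theorems only, no definition, no new named fact;
X3♯(G-ord)/X4♯(G-ord) stay CONSTRUCTION-SHAPED; no label moves.

WHAT THIS FILE DOES. The sub-classes X3♯(G-ord), X4♯(G-ord) are DEFINED (`PotGoodOrdinary.lean`,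
gen 0) through Delbourgo's standing hypothesis `TypeGOrd W p`: good reduction WITH the unit-root
condition above `p` over a subfield of a `p`-th cyclotomic field — and are NAMED, in the census
and in every document of the cell, "additive, potentially good ORDINARY". That the two agree was
so far the prose data dictionary (module docstring of `PotGoodOrdinary.lean`; AUDIT-X34-GORD §3:
"potentially good ordinary ⟹ (G) at every odd `p`") checked on 1280/1280 census pairs. Here it is
a KERNEL THEOREM at every `p ≥ 5`:

* `typeGOrd_of_good_unitRoot_baseChange` — `E/ℚ` (globally minimal `W`) ADDITIVE at `p ≥ 5`;
  if for SOME number field `F` and SOME place `w ∋ p` of `F` the base change `E_F` has good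
  reduction at `w` with the unit-root (ordinary) condition, then `TypeGOrd W p`.
* `typeGOrd_iff_exists_good_unitRoot` — **`TypeGOrd W p ↔ ∃ F, ∃ w ∋ p, E_F good ordinary at
  `w`** (the sub-class predicate IS "potentially good ordinary");
  `classX4Gord_iff_classX4_and_exists_good_unitRoot`, `classX3Gord_iff_…` (X?♯(G-ord) =
  X? ∩ {potentially good ordinary at `p`}).
* `not_hasUnitRootAt_baseChange_of_not_semistabilityIndex_dvd` — conversely, when
  `e_E(p) ∤ p − 1` (additive-p4's tame cell `SubTprime`, "(T′)": potentially good, not (G)) the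
  pair is potentially SUPERSINGULAR: at EVERY place of good reduction above `p` of EVERY number
  field the unit-root condition FAILS (`SubTprime.not_hasUnitRootAt_baseChange`).

PROOF. Good reduction of `E_F` at `w ∋ p` gives `ord_p j ≥ 0` (Silverman VII.5.5), so
`e = e_E(p) ∈ {2,3,4,6}` (gen 5), and (G) is `e ∣ p − 1` (gen 2). If `3 ∣ e` then
`3 ∤ ord_p Δ_min`, `j ≡ 0 (mod p)` (gen 3), the reduced curve at `w` has `j̃ = 0`, and by the
SUPERSINGULAR half of Deuring's criterion over `k_w = 𝔽_{p^f}` (`SpecialJSupersingular.lean`,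
this generation: Euler's criterion + one Lucas step) ordinarity at `w` forces `3 ∣ p − 1`; likewise
`4 ∣ e` forces `j̃ = 1728`, `4 ∣ p − 1`. So `e ∣ p − 1`: (G). (G)-ORDINARY: for `e ≠ 2` by gen 5's
`typeGOrd_iff_typeG_of_semistabilityIndex_ne_two`; for `e = 2` the twist `E' = E^{(p*)}` is GOOD
at `p` (gen 3) and ordinarity is carried from `(F, w)` to `(ℚ, p)` for `E'` through `M = F(√p*)`
(Mathlib `SplittingField` of `X² − p*` over `F`): up `F → M` (gen 4
`hasUnitRootAt_baseChange_iff_of_hasGoodReductionAt`), across `E_M ≅ E'_M`, down `M → ℚ` since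
`E'` is good at `p`; then gen 0's `typeGOrd_of_goodOrd_quadraticTwist`. No Galois representations.

Scope (honest): `p = 3` is not covered (wild defects; gens 7/8 treat (G) at `3` by Tate's
algorithm); `p = 2` is vacuous for (G) on the additive locus. No label changes, no pair is booked;
the located gap (Eisenstein-side divisibility on a datum ramified at `p`, AUDIT §0) is untouched.
References: D. Delbourgo, Compositio Math. 113 (1998) §1.2 Lemma, §1.5 (G), Thm. 3; M. Deuring,
Abh. Math. Sem. Hamburg 14 (1941); J.-P. Serre, J. Tate, Ann. of Math. 88 (1968) §2;
J. H. Silverman, *AEC* VII.5.1, VII.5.4–5.5, V.4.1(a), Ex. V.4.4–4.5; AUDIT-X34-GORD.md §3.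
-/

noncomputable section

open scoped Classical NumberField

open Polynomial WeierstrassCurve IsDedekindDomain IsDedekindDomain.HeightOneSpectrum NumberField
  Rat.HeightOneSpectrum Literature.NumberTheory.EllipticCurves
  Literature.NumberTheory.EllipticCurves.Rank1Residual

namespace Summit.BirchSwinnertonDyer.Rank1Residual.Additive

/-! ### Integral `j` from good reduction upstairs (any number field) -/

/-- **Potential good reduction forces integral `j`** (Silverman *AEC* VII.5.5; gen 2's
`padicValRat_j_nonneg_of_typeG` for an ARBITRARY number field `F`): if `E_F` is good at a place
`w ∋ p`, then `ord_p j(E) ≥ 0` (`w(j) ≤ 1` and `w(j) = v_p(j)^{e(w|p)}`, `valuation_liesOver`). -/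
theorem padicValRat_j_nonneg_of_hasGoodReductionAt_baseChange (W : WeierstrassCurve ℚ)
    [W.IsElliptic] (p : ℕ) [hp : Fact p.Prime] {F : Type*} [Field F] [NumberField F]
    {w : HeightOneSpectrum (𝓞 F)} (hw : (p : 𝓞 F) ∈ w.asIdeal)
    (hgood : (W.baseChange F).HasGoodReductionAt w) : 0 ≤ padicValRat p W.j := by
  by_cases hj0 : W.j = 0
  · simp [hj0]
  haveI : (W.baseChange F).IsElliptic := by rw [baseChange]; infer_instance
  have hjw := valuation_j_le_one_of_hasGoodReductionAt (W.baseChange F) w hgood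
  have hjF : (W.baseChange F).j = algebraMap ℚ F W.j := W.map_j (algebraMap ℚ F)
  rw [hjF] at hjw
  set v : HeightOneSpectrum ℤ := (Rat.HeightOneSpectrum.primesEquiv (R := ℤ)).symm ⟨p, hp.out⟩
    with hvdef
  have hv : Rat.HeightOneSpectrum.natGenerator v = p :=
    congrArg Subtype.val ((Rat.HeightOneSpectrum.primesEquiv (R := ℤ)).apply_symm_apply ⟨p, hp.out⟩)
  have hunder : w.asIdeal.under ℤ = v.asIdeal := by
    have hle : v.asIdeal ≤ w.asIdeal.under ℤ := by
      rw [Rat.HeightOneSpectrum.asIdeal_eq_span_natGenerator_int, hv, Ideal.span_le,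
        Set.singleton_subset_iff, SetLike.mem_coe, Ideal.under_def, Ideal.mem_comap, map_natCast]
      exact hw
    exact (v.isMaximal.eq_of_le (Ideal.IsPrime.ne_top inferInstance) hle).symm
  haveI : w.asIdeal.LiesOver v.asIdeal := ⟨hunder.symm⟩
  have he : v.asIdeal.ramificationIdx' w.asIdeal ≠ 0 :=
    Ideal.IsDedekindDomain.ramificationIdx'_ne_zero_of_liesOver w.asIdeal v.ne_bot
  have hvj : v.valuation ℚ W.j ≤ 1 := by
    rw [← pow_le_one_iff he, valuation_liesOver (K := ℚ) (L := F) v w W.j]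
    exact hjw
  rw [Rat.HeightOneSpectrum.valuation_eq_exp_neg_padicValRat v hj0, hv, ← WithZero.exp_zero,
    WithZero.exp_le_exp] at hvj
  linarith

/-! ### The residue field: `j̃ ∈ {0, 1728}` at a place of good ORDINARY reduction pins `p mod 12` -/

section Residue

variable {F : Type*} [Field F] [NumberField F] (V : WeierstrassCurve F) [V.IsElliptic]
  (w : HeightOneSpectrum (𝓞 F)) {p : ℕ}

/-- **Good reduction with `j ≡ 0` above `p ≥ 5`, `p ≢ 1 (mod 3)`, is SUPERSINGULAR** — at ANY place
`w ∋ p` of ANY number field (residue field `𝔽_{p^f}`, any `f`): the unit-root condition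
`HasUnitRootAt` fails (`SpecialJ.dvd_trace_of_j_eq_zero_of_ringChar_eq` on the reduced curve,
`reductionAt_j_eq_zero`). Silverman *AEC* V.4.1(a), Ex. V.4.4. -/
theorem not_hasUnitRootAt_of_valuation_j_lt_one_of_not_three_dvd (hp : p.Prime) (hp5 : 5 ≤ p)
    (h3 : ¬ 3 ∣ p - 1) (hpw : (p : 𝓞 F) ∈ w.asIdeal) (hgood : V.HasGoodReductionAt w)
    (hj : w.valuation F V.j < 1) : ¬ V.HasUnitRootAt w := by
  haveI : Fact p.Prime := ⟨hp⟩
  haveI : (V.reductionAt w).IsElliptic := isElliptic_reductionAt hgood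
  rw [WeierstrassCurve.hasUnitRootAt_iff, ringChar_residueField_eq w hp hpw, not_not]
  exact SpecialJ.dvd_trace_of_j_eq_zero_of_ringChar_eq (V.reductionAt w)
    (ringChar_residueField_eq w hp hpw) hp5 (reductionAt_j_eq_zero V w hgood hj) h3

/-- **Good reduction with `j ≡ 1728` above `p ≥ 5`, `p ≢ 1 (mod 4)`, is SUPERSINGULAR** (any number
field, any place). Silverman *AEC* V.4.1(a), Ex. V.4.5. -/
theorem not_hasUnitRootAt_of_valuation_j_sub_lt_one_of_not_four_dvd (hp : p.Prime) (hp5 : 5 ≤ p)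
    (h4 : ¬ 4 ∣ p - 1) (hpw : (p : 𝓞 F) ∈ w.asIdeal) (hgood : V.HasGoodReductionAt w)
    (hj : w.valuation F (V.j - 1728) < 1) : ¬ V.HasUnitRootAt w := by
  haveI : Fact p.Prime := ⟨hp⟩
  haveI : (V.reductionAt w).IsElliptic := isElliptic_reductionAt hgood
  rw [WeierstrassCurve.hasUnitRootAt_iff, ringChar_residueField_eq w hp hpw, not_not]
  exact SpecialJ.dvd_trace_of_j_eq_of_ringChar_eq (V.reductionAt w)
    (ringChar_residueField_eq w hp hpw) hp5 (reductionAt_j_eq_of_valuation_lt_one V w hgood hj) h4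

end Residue

/-! ### Potentially good ORDINARY at `p ≥ 5` ⟹ Delbourgo's (G) -/

section Main

variable (W : WeierstrassCurve ℚ) [W.IsElliptic] [W.IsGloballyMinimal] (p : ℕ) [hp : Fact p.Prime]

/-- **Potentially good ORDINARY ⟹ (G)** (`p ≥ 5`, `E` additive at `p`, `W` globally minimal). If
`E_F` is good with the unit-root condition at some place `w ∋ p` of some number field `F`, then
`E` is of Delbourgo type (G) at `p`: the semistability defect `e_E(p)` divides `p − 1`. The defect
is `2, 3, 4` or `6`; `3 ∣ e` (resp. `4 ∣ e`) makes the reduction at `w` have `j̃ = 0`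
(resp. `1728`), which is supersingular unless `3 ∣ p − 1` (resp. `4 ∣ p − 1`)
(`SpecialJSupersingular`), contradicting the unit-root condition. Serre–Tate 1968 §2 / Delbourgo
1998 §1.2 Lemma (iv) ("`p ≡ 1 (mod d)`"), here by valuations + Deuring only. -/
theorem typeG_of_good_unitRoot_baseChange (hp5 : 5 ≤ p) (hadd : Addv W p)
    {F : Type*} [Field F] [NumberField F] {w : HeightOneSpectrum (𝓞 F)}
    (hw : (p : 𝓞 F) ∈ w.asIdeal) (hgood : (W.baseChange F).HasGoodReductionAt w)
    (hunit : (W.baseChange F).HasUnitRootAt w) : TypeG W p := by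
  have hp2 : p ≠ 2 := by omega
  haveI : (W.baseChange F).IsElliptic := by rw [baseChange]; infer_instance
  have hj : 0 ≤ padicValRat p W.j :=
    padicValRat_j_nonneg_of_hasGoodReductionAt_baseChange W p hw hgood
  have hjF : (W.baseChange F).j = algebraMap ℚ F W.j := W.map_j (algebraMap ℚ F)
  -- `3 ∣ e → 3 ∣ p − 1`
  have h3 : 3 ∣ semistabilityIndex W p → 3 ∣ p - 1 := by
    intro h3e
    by_contra h3p
    have h3v : ¬ 3 ∣ padicValInt p W.minimalDiscriminantInt := by
      intro h
      have : 3 ∣ 4 := dvd_trans h3e (semistabilityIndex_dvd_four_of_three_dvd W p h)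
      omega
    have hj0 := j_eq_zero_or_padicValRat_j_pos_of_not_three_dvd W p hj h3v
    have hlt : w.valuation F (W.baseChange F).j < 1 := by
      rw [hjF]; exact valuation_algebraMap_lt_one_of_padicValRat_pos p w hw hj0
    exact not_hasUnitRootAt_of_valuation_j_lt_one_of_not_three_dvd (W.baseChange F) w hp.out hp5
      h3p hw hgood hlt hunit
  -- `4 ∣ e → 4 ∣ p − 1`
  have h4 : 4 ∣ semistabilityIndex W p → 4 ∣ p - 1 := by
    intro h4e
    by_contra h4p
    have h2v : ¬ 2 ∣ padicValInt p W.minimalDiscriminantInt := by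
      intro h
      have : 4 ∣ 6 := dvd_trans h4e (semistabilityIndex_dvd_six_of_two_dvd W p h)
      omega
    have hj0 := j_eq_or_padicValRat_j_sub_pos_of_not_two_dvd W p hp5 hj h2v
    have hlt : w.valuation F ((W.baseChange F).j - 1728) < 1 := by
      have h1728 : (W.baseChange F).j - 1728 = algebraMap ℚ F (W.j - 1728) := by
        rw [map_sub, hjF, map_ofNat]
      rw [h1728]
      exact valuation_algebraMap_lt_one_of_padicValRat_pos p w hw
        (hj0.imp (fun h ↦ sub_eq_zero.mpr h) id)
    exact not_hasUnitRootAt_of_valuation_j_sub_lt_one_of_not_four_dvd (W.baseChange F) w hp.out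
      hp5 h4p hw hgood hlt hunit
  -- `2 ∣ p − 1`
  have h2 : 2 ∣ p - 1 := by
    obtain ⟨k, hk⟩ := hp.out.odd_of_ne_two hp2
    exact ⟨k, by omega⟩
  rw [typeG_iff_not_subM_and_semistabilityIndex_dvd W p hp5]
  refine ⟨not_lt.mpr hj, ?_⟩
  rcases semistabilityIndex_mem_of_addv W p hp5 hadd hj with he | he | he | he <;> rw [he]
  · exact h2
  · exact h3 (by rw [he])
  · exact h4 (by rw [he])
  · have h3' := h3 (by rw [he]; norm_num)
    omega

/-! ### The defect-2 case: ordinarity carried to the twist `E^{(p*)}` through `F(√p*)` -/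

omit [W.IsGloballyMinimal] in
/-- **Ordinarity upstairs makes a GOOD twist ORDINARY.** Let `E_F` be good with the unit-root
condition at a place `w ∋ p` of a number field `F`, and let `Wd` be a globally minimal model of a
quadratic twist `E^{(d)}` (`d ≠ 0`) which has GOOD reduction at `p`. Then `Wd` is good ORDINARY at
`p` (`GoodOrd Wd p`, `p ∤ a_p(E^{(d)})`). Proof: over the quadratic extension `M = F(√d)` (Mathlib's
splitting field of `X² − d` over `F`; a number field) and a place `𝔓 ∣ w`: `E_M` is good with unit
root at `𝔓` (UP, gen 4's `hasUnitRootAt_baseChange_iff_of_hasGoodReductionAt`), `E_M ≅ E^{(d)}_M`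
(`√d ∈ M`), and since `E^{(d)}` is already good at `p` over `ℚ` the unit-root condition DESCENDS
from `𝔓` to `p` (same lemma). Silverman *AEC* V.2.3.1 (`a_{q^f}` from `a_q`), X.2 (twists). -/
theorem goodOrd_of_good_unitRoot_baseChange_of_twist
    {F : Type} [Field F] [NumberField F] {w : HeightOneSpectrum (𝓞 F)}
    (hw : (p : 𝓞 F) ∈ w.asIdeal) (hgood : (W.baseChange F).HasGoodReductionAt w)
    (hunit : (W.baseChange F).HasUnitRootAt w) (d : ℚ) (hd0 : d ≠ 0)
    (Wd : WeierstrassCurve ℚ) [Wd.IsElliptic] [Wd.IsGloballyMinimal] (C₀ : VariableChange ℚ)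
    (hWd : C₀ • W.quadraticTwist d = Wd) (hgoodp : Wd.HasGoodReductionAtPrime p) :
    GoodOrd Wd p := by
  haveI : (W.baseChange F).IsElliptic := by rw [baseChange]; infer_instance
  -- the quadratic extension `M = F(√d)`
  let f : F[X] := X ^ 2 - Polynomial.C (algebraMap ℚ F d)
  let M : Type := f.SplittingField
  haveI : NumberField M := NumberField.of_module_finite F M
  have hspl := SplittingField.splits f
  have hdeg : (f.map (algebraMap F M)).degree ≠ 0 := by
    simp only [f, Polynomial.map_sub, Polynomial.map_pow, map_X, map_C]
    rw [degree_X_pow_sub_C (by norm_num)]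
    norm_num
  obtain ⟨g, hg⟩ := hspl.exists_eval_eq_zero hdeg
  have hg2 : (algebraMap ℚ M) d = 1 * g ^ 2 := by
    simp only [f, Polynomial.map_sub, Polynomial.map_pow, map_X, map_C, eval_sub, eval_pow, eval_X,
      eval_C, sub_eq_zero] at hg
    rw [IsScalarTower.algebraMap_apply ℚ F M, hg, one_mul]
  have hg0 : g ≠ 0 := by
    intro h0
    have : (algebraMap ℚ M) d = 0 := by rw [hg2, h0]; simp
    rw [map_eq_zero] at this
    exact hd0 this
  -- a place `𝔓` of `M` above `w`
  haveI := w.isMaximal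
  obtain ⟨Q, hQmax, hQover⟩ :=
    Ideal.exists_maximal_ideal_liesOver_of_isIntegral (S := 𝓞 M) w.asIdeal
  set 𝔓 : HeightOneSpectrum (𝓞 M) :=
    ⟨Q, hQmax.isPrime, Ideal.ne_bot_of_liesOver_of_ne_bot w.ne_bot Q⟩ with h𝔓def
  haveI h𝔓w' : 𝔓.asIdeal.LiesOver w.asIdeal := hQover
  have h𝔓w : 𝔓.asIdeal.under (𝓞 F) = w.asIdeal := hQover.over.symm
  have hp𝔓 : (p : 𝓞 M) ∈ 𝔓.asIdeal := by
    have : (p : 𝓞 F) ∈ 𝔓.asIdeal.under (𝓞 F) := by rw [h𝔓w]; exact hw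
    rw [Ideal.under_def, Ideal.mem_comap, map_natCast] at this
    exact this
  -- the place `v` of `ℚ` over `p`
  set v : HeightOneSpectrum (𝓞 ℚ) := (primesEquiv (R := 𝓞 ℚ)).symm ⟨p, hp.out⟩ with hvdef
  have hpv : (p : 𝓞 ℚ) ∈ v.asIdeal :=
    (natCast_mem_asIdeal_iff_eq_primesEquiv_symm v hp.out).mpr rfl
  have h𝔓v : 𝔓.asIdeal.under (𝓞 ℚ) = v.asIdeal := under_eq_asIdeal_of_natCast_mem p 𝔓 hp𝔓
  -- UP: `E_M` good with unit root at `𝔓`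
  have hWM : (W.baseChange F).baseChange M = W.baseChange M := by
    rw [baseChange, show algebraMap F M = (IsScalarTower.toAlgHom ℚ F M : F →+* M) from rfl]
    exact W.map_baseChange (IsScalarTower.toAlgHom ℚ F M)
  have hgWM : (W.baseChange M).HasGoodReductionAt 𝔓 := by
    rw [← hWM]
    exact hasGoodReductionAt_baseChange_of_hasGoodReductionAt (W.baseChange F) M w 𝔓 hgood
  have huWM : (W.baseChange M).HasUnitRootAt 𝔓 := by
    rw [← hWM]
    exact (hasUnitRootAt_baseChange_iff_of_hasGoodReductionAt (W.baseChange F) M p hw h𝔓w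
      hgood).mpr hunit
  -- ACROSS: `W_M ≅ Wd_M` (`d` is a square in `M`)
  have htw : (W.quadraticTwist d).baseChange M = (W.baseChange M).quadraticTwist (1 * g ^ 2) := by
    rw [← hg2]
    exact map_quadraticTwist W (algebraMap ℚ M) d
  haveI : NeZero (2 : M) := ⟨two_ne_zero⟩
  haveI : (W.baseChange M).IsElliptic := by rw [baseChange]; infer_instance
  obtain ⟨C₁, hC₁⟩ := exists_variableChange_quadraticTwist_one (W.baseChange M)
  obtain ⟨C₂, hC₂⟩ := exists_variableChange_quadraticTwist_mul_sq (W.baseChange M) 1 g hg0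
  have hWdM : Wd.baseChange M = (C₀.map (algebraMap ℚ M)) • (W.quadraticTwist d).baseChange M := by
    rw [← hWd, baseChange, baseChange, ← map_variableChange]
  have hiso : (C₀.map (algebraMap ℚ M) * (C₂ * C₁)) • W.baseChange M = Wd.baseChange M := by
    rw [mul_smul, mul_smul, hC₁, hC₂, ← htw, hWdM]
  have hgDM : (Wd.baseChange M).HasGoodReductionAt 𝔓 := by
    rw [← hiso]
    exact (hasGoodReductionAt_smul_iff_holds 𝔓 (W.baseChange M)
      (C₀.map (algebraMap ℚ M) * (C₂ * C₁))).mpr hgWM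
  have huDM : (Wd.baseChange M).HasUnitRootAt 𝔓 := by
    rw [← hiso]
    exact (hasUnitRootAt_smul_iff (W.baseChange M) (C₀.map (algebraMap ℚ M) * (C₂ * C₁)) 𝔓
      hgWM).mpr huWM
  -- DOWN: `Wd` is good at `p`, so ordinarity descends to `ℚ`
  have hgDv : Wd.HasGoodReductionAt v := hasGoodReductionAt_of_hasGoodReductionAtPrime p Wd hgoodp
  have huDv : Wd.HasUnitRootAt v :=
    (hasUnitRootAt_baseChange_iff_of_hasGoodReductionAt Wd M p hpv h𝔓v hgDv).mp huDM
  exact ⟨hgoodp, (Wd.hasUnitRootAt_iff_not_dvd_frobeniusTrace v hp.out hpv).mp huDv⟩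

/-- **Potentially good ORDINARY ⟹ (G)-ORDINARY** (`p ≥ 5`, `E` additive at `p`, `W` globally
minimal): if `E_F` has good reduction with the unit-root condition at SOME place `w ∋ p` of SOME
number field `F`, then `TypeGOrd W p` — Delbourgo's standing hypothesis "(G) with potential good
ordinary reduction" (Compositio 113, Thm. 3 / Prop. 4 / Main Conjecture). Type (G) by
`typeG_of_good_unitRoot_baseChange`; the ordinary bit is automatic for defect `3, 4, 6` (gen 5
`typeGOrd_iff_typeG_of_semistabilityIndex_ne_two`) and for defect `2` is carried to the good
twist `E^{(p*)}` (`goodOrd_of_good_unitRoot_baseChange_of_twist`, gen 3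
`hasGoodReductionAtPrime_twist_pStar`, gen 0 `typeGOrd_of_goodOrd_quadraticTwist`). -/
theorem typeGOrd_of_good_unitRoot_baseChange (hp5 : 5 ≤ p) (hadd : Addv W p)
    {F : Type} [Field F] [NumberField F] {w : HeightOneSpectrum (𝓞 F)}
    (hw : (p : 𝓞 F) ∈ w.asIdeal) (hgood : (W.baseChange F).HasGoodReductionAt w)
    (hunit : (W.baseChange F).HasUnitRootAt w) : TypeGOrd W p := by
  have hG : TypeG W p := typeG_of_good_unitRoot_baseChange W p hp5 hadd hw hgood hunit
  by_cases he : semistabilityIndex W p = 2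
  · have hp2 : p ≠ 2 := by omega
    have hj : 0 ≤ padicValRat p W.j :=
      padicValRat_j_nonneg_of_hasGoodReductionAt_baseChange W p hw hgood
    set d : ℚ := (-1 : ℚ) ^ (p / 2) * p with hddef
    have hd0 : d ≠ 0 :=
      mul_ne_zero (pow_ne_zero _ (by norm_num)) (by exact_mod_cast hp.out.ne_zero)
    haveI : NeZero (2 : ℚ) := ⟨two_ne_zero⟩
    haveI : (W.quadraticTwist d).IsElliptic := W.isElliptic_quadraticTwist hd0
    obtain ⟨C, hC⟩ := hasGlobalMinimalModel_rat_holds (W.quadraticTwist d)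
    haveI := hC
    have hgoodp : (C • W.quadraticTwist d).HasGoodReductionAtPrime p :=
      hasGoodReductionAtPrime_twist_pStar W p hp5 hj ((semistabilityIndex_eq_two_iff W p).mp he)
        (C • W.quadraticTwist d) C rfl
    have hord : GoodOrd (C • W.quadraticTwist d) p :=
      goodOrd_of_good_unitRoot_baseChange_of_twist W p hw hgood hunit d hd0
        (C • W.quadraticTwist d) C rfl hgoodp
    exact typeGOrd_of_goodOrd_quadraticTwist W p hp2 (C • W.quadraticTwist d) C rfl hord
  · exact (typeGOrd_iff_typeG_of_semistabilityIndex_ne_two W p hp5 hadd he).mpr hG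

/-- **(G)-ORDINARY ⟺ POTENTIALLY GOOD ORDINARY** (`p ≥ 5`, `E` additive at `p`, `W` globally
minimal): Delbourgo's standing hypothesis `TypeGOrd W p` holds iff for SOME number field `F` and
SOME place `w ∋ p` the base change `E_F` is good with the unit-root (ordinary) condition at `w`.
So the sub-class predicate of X3♯(G-ord)/X4♯(G-ord) IS "additive, potentially good ordinary at
`p`" — the census's NAME for the cell — as a kernel theorem (the prose dictionary of
`PotGoodOrdinary.lean` / AUDIT-X34-GORD §3, previously checked as data on 1280/1280 pairs). -/
theorem typeGOrd_iff_exists_good_unitRoot (hp5 : 5 ≤ p) (hadd : Addv W p) :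
    TypeGOrd W p ↔ ∃ (F : Type) (_ : Field F) (_ : NumberField F) (w : HeightOneSpectrum (𝓞 F)),
      (p : 𝓞 F) ∈ w.asIdeal ∧ (W.baseChange F).HasGoodReductionAt w ∧
        (W.baseChange F).HasUnitRootAt w := by
  constructor
  · rintro ⟨L, iF, iN, iC, F, hF⟩
    haveI : NumberField F := NumberField.of_module_finite ℚ F
    obtain ⟨w, hw⟩ := exists_heightOneSpectrum_natCast_mem F p
    exact ⟨F, inferInstance, inferInstance, w, hw, hF w hw⟩
  · rintro ⟨F, _, _, w, hw, hgood, hunit⟩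
    exact typeGOrd_of_good_unitRoot_baseChange W p hp5 hadd hw hgood hunit

/-- **X4♯(G-ord) = X4 ∩ {potentially good ORDINARY at `p`}** (`p ≥ 5`): the sub-class predicate
`ClassX4Gord` (gen 0) is the tree's class X4 together with good ordinary reduction of `E` over some
number field at some place above `p`. -/
theorem classX4Gord_iff_classX4_and_exists_good_unitRoot (hp5 : 5 ≤ p) :
    ClassX4Gord W p ↔ ClassX4 W p ∧
      ∃ (F : Type) (_ : Field F) (_ : NumberField F) (w : HeightOneSpectrum (𝓞 F)),
        (p : 𝓞 F) ∈ w.asIdeal ∧ (W.baseChange F).HasGoodReductionAt w ∧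
          (W.baseChange F).HasUnitRootAt w :=
  ⟨fun h ↦ ⟨h.classX4, (typeGOrd_iff_exists_good_unitRoot W p hp5 h.addv.2).mp h.typeGOrd⟩,
    fun ⟨hX, hex⟩ ↦ ⟨hX, (typeGOrd_iff_exists_good_unitRoot W p hp5 hX.2.1).mpr hex⟩⟩

/-- **X3♯(G-ord) = X3 ∩ {potentially good ORDINARY at `p`}** (`p ≥ 5`). -/
theorem classX3Gord_iff_classX3_and_exists_good_unitRoot (hp5 : 5 ≤ p) :
    ClassX3Gord W p ↔ ClassX3 W p ∧
      ∃ (F : Type) (_ : Field F) (_ : NumberField F) (w : HeightOneSpectrum (𝓞 F)),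
        (p : 𝓞 F) ∈ w.asIdeal ∧ (W.baseChange F).HasGoodReductionAt w ∧
          (W.baseChange F).HasUnitRootAt w :=
  ⟨fun h ↦ ⟨h.classX3, (typeGOrd_iff_exists_good_unitRoot W p hp5 h.addv).mp h.typeGOrd⟩,
    fun ⟨hX, hex⟩ ↦ ⟨hX, (typeGOrd_iff_exists_good_unitRoot W p hp5 hX.2).mpr hex⟩⟩

/-! ### The tame non-(G) cell is potentially SUPERSINGULAR -/

/-- **`e_E(p) ∤ p − 1` ⟹ potentially SUPERSINGULAR everywhere** (`p ≥ 5`, `E` additive at `p`):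
at EVERY place `w ∋ p` of EVERY number field `F` where `E_F` is good, the unit-root condition FAILS
(`p ∣ a_w`). Contrapositive of `typeG_of_good_unitRoot_baseChange` + gen 2's (G) ⟺ `e ∣ p − 1`. -/
theorem not_hasUnitRootAt_baseChange_of_not_semistabilityIndex_dvd (hp5 : 5 ≤ p)
    (hadd : Addv W p) (hnd : ¬ semistabilityIndex W p ∣ p - 1)
    {F : Type} [Field F] [NumberField F] {w : HeightOneSpectrum (𝓞 F)}
    (hw : (p : 𝓞 F) ∈ w.asIdeal) (hgood : (W.baseChange F).HasGoodReductionAt w) :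
    ¬ (W.baseChange F).HasUnitRootAt w := fun hunit ↦
  hnd ((typeG_iff_not_subM_and_semistabilityIndex_dvd W p hp5).mp
    (typeG_of_good_unitRoot_baseChange W p hp5 hadd hw hgood hunit)).2

/-- **Additive-p4's tame cell (T′) is potentially supersingular** (`p ≥ 5`): on `SubTprime W p`
(`¬(ord_p j < 0) ∧ f_p = 2 ∧ e_E(p) ∤ p − 1`, `SharpenedStatements.lean`) and `Addv W p`, good
reduction of `E_F` above `p` is NEVER ordinary, for any number field `F` — the census split
`sub_exhaustive` separates ordinary from supersingular potential good reduction along `e ∣ p − 1`. -/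
theorem SubTprime.not_hasUnitRootAt_baseChange (hp5 : 5 ≤ p) (hT : SubTprime W p)
    (hadd : Addv W p) {F : Type} [Field F] [NumberField F] {w : HeightOneSpectrum (𝓞 F)}
    (hw : (p : 𝓞 F) ∈ w.asIdeal) (hgood : (W.baseChange F).HasGoodReductionAt w) :
    ¬ (W.baseChange F).HasUnitRootAt w :=
  not_hasUnitRootAt_baseChange_of_not_semistabilityIndex_dvd W p hp5 hadd hT.2.2 hw hgood

/-- **(T′) pairs are not (G)-ordinary** (`p ≥ 5`): they lie in neither X3♯(G-ord) nor X4♯(G-ord). -/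
theorem SubTprime.not_typeGOrd (hp5 : 5 ≤ p) (hT : SubTprime W p) : ¬ TypeGOrd W p := fun hG ↦
  hT.2.2 ((typeG_iff_not_subM_and_semistabilityIndex_dvd W p hp5).mp hG.typeG).2

end Main

end Summit.BirchSwinnertonDyer.Rank1Residual.Additive

end
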